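import Literature.MathematicalPhysics.QuantumFieldTheory.Federbush1986.NonAbelianDualityTheorem2

/-!
# `Federbush1986.NonAbelianDualityTrivialWitness` — [Federbush1987PhaseCellVI] Theorems 1–2 as typed: the HYPOTHESIS PACKAGE
# (`IsFederbushSystem` ∧ the T-F6-1 chart binder ∧ the BCH binder) IS SATISFIABLE — a kernel non-vacuity witness by the
# trivial group (consistency check of the typing; NOT a model of Yang–Mills)

statement-level skeleton of published theorems with citation tags; proofs where landed; nothing here is a claim about the Yang–Mills mass gap

CITATION HEADER.  P. Federbush, *A phase cell approach to Yang–Mills theory. VI. Non-abelian lattice-continuum duality*,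
Ann. Inst. H. Poincaré **47** (1987) 17–23 [Federbush1987PhaseCellVI]; *… I*, Commun. Math. Phys. **107** (1986) 319–329
[Federbush1986PhaseCellI], §1 Fig. 1–2 p. 321–322 (the paths `Γ_x`).  Unit `lit-balaban-r19` gen 5 (owner of the F6 statement
file).  PURPOSE (review culture of this cell, G.5-40 «self-played degenerate-model check»; cf. unit p04's vacuity audits):
`theorem1_of_chart` (p248765) and `theorem2Oriented_of_chart` (p253953) are proved for an ABSTRACT `S : BlockSpinSystem` under
`S.IsFederbushSystem` (11 fields) and two binders; if these hypotheses were jointly contradictory both theorems would be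
vacuous.  This file exhibits ONE `BlockSpinSystem` satisfying all of them — the degenerate scheme with the trivial group
`G = PUnit`, `𝔤 = (Fin 0 → ℝ)`, Federbush's path words `Γ_x` realised LITERALLY (`paths_canonical` is the only non-trivial
field: the sign/length pattern of `canonWord r e x` depends on `x` alone, so a fixed index scheme `vars r e`, `paths x`
reproduces every `Γ_x` at every level and edge) — and records that Theorems 1–2 apply to it.  A witness with a non-trivial
compact Lie group (print: «a compact simple Lie group») would require Federbush's actual block-spin function; out of scope.

WHAT THIS MODULE PROVES (one `def` — the witness scheme `trivialSystem` — and theorems; no `Prop` definition, no named fact;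
axioms standard).  §1 the sign pattern of `canonWord` is level/edge independent (`map_snd_canonWord`); the index scheme
`witnessVars`/`witnessPaths` realises `Γ_x` (`witnessPaths_map`).  §2 `trivialSystem`, **`trivialSystem_isFederbushSystem`**,
`trivialSystem_chart`, `trivialSystem_bch`, **`trivialSystem_theorem1`**, **`trivialSystem_theorem2`** (the hypotheses of the two
theorems of record are jointly satisfiable, and the theorems instantiate).
-/

namespace Literature.MathematicalPhysics.QuantumFieldTheory.Federbush1986

noncomputable section

open Filter Metric Set
open scoped Topology BigOperators

namespace TrivialWitness

/-! ## §1 The sign pattern of Federbush's words and a level-independent index scheme -/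

/-- The orientation pattern of `Γ_x`: `true` along the source comb tree and the straight segment, `false` down the target
comb tree — a function of the block vertex `x` alone. [cite: Federbush1986PhaseCellI, §1 Fig. 2 p. 322] -/
def signs (x : Fin 16) : List Bool :=
  ((List.finRange 4).filterMap fun μ => if blockOffset x μ = 1 then some true else none) ++ [true, true] ++
    ((List.finRange 4).filterMap fun μ => if blockOffset x μ = 1 then some false else none).reverse

/-- The sign pattern of `canonWord r e x` is `signs x`, whatever the level and the edge. [cite: Federbush1986PhaseCellI,
§1 Fig. 1–2 p. 321–322] -/
theorem map_snd_canonWord (r : ℕ) (e : Edge r) (x : Fin 16) : (canonWord r e x).map Prod.snd = signs x := by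
  have hcomb : ∀ (b o : Fin 4 → ℤ) (sgn : Bool),
      ((List.finRange 4).filterMap fun μ =>
          if o μ = 1 then some ((⟨b + prefOffset o μ, μ⟩ : Edge (r + 1)), sgn) else none).map Prod.snd =
        (List.finRange 4).filterMap fun μ => if o μ = 1 then some sgn else none := by
    intro b o sgn
    rw [List.map_filterMap]
    congr 1
    funext μ
    split_ifs <;> rfl
  unfold canonWord combUp combDown straightSeg signs
  rw [List.map_append, List.map_append, List.map_reverse, hcomb, hcomb]
  rfl

/-- `Γ_x` has at most ten letters, so `signs x` has. [cite: Federbush1986PhaseCellI, §1 Fig. 2 p. 322] -/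
theorem length_signs_le (x : Fin 16) : (signs x).length ≤ 10 := by
  have h := BlockSpinSystem.length_canonWord_le (⟨0, 0⟩ : Edge 0) x
  rw [← map_snd_canonWord 0 ⟨0, 0⟩ x, List.length_map]
  exact h

/-- The length of `Γ_x` is that of `signs x`. [cite: Federbush1986PhaseCellI, §1 Fig. 2 p. 322] -/
theorem length_canonWord_eq (r : ℕ) (e : Edge r) (x : Fin 16) : (canonWord r e x).length = (signs x).length := by
  rw [← map_snd_canonWord r e x, List.length_map]

/-- The index scheme: variable number `16x + k` is the `k`-th letter of `Γ_x` (padding elsewhere).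
[cite: Federbush1987PhaseCellVI, (1)–(2) p. 18; Federbush1986PhaseCellI, §1 p. 321–322] -/
def witnessVars (r : ℕ) (e : Edge r) (i : Fin 256) : Edge (r + 1) :=
  ((canonWord r e ⟨i.val / 16, by omega⟩).getD (i.val % 16) (⟨0, 0⟩, true)).1

/-- The path words in the variables: `Γ_x = ((16x + k, sign_k))_{k < |Γ_x|}`. [cite: Federbush1986PhaseCellI, §1 Fig. 2 p. 322] -/
def witnessPaths (x : Fin 16) : List (Fin 256 × Bool) :=
  (List.finRange (signs x).length).map fun k =>
    (⟨16 * x.val + k.val, by have := length_signs_le x; omega⟩, (signs x).getD k.val true)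

/-- The index scheme realises Federbush's words at every level and edge (`paths_canonical`).
[cite: Federbush1986PhaseCellI, §1 Fig. 1–2, (1.1)–(1.2) p. 321–322; Federbush1987PhaseCellVI, (1)–(2) p. 18] -/
theorem witnessPaths_map (r : ℕ) (e : Edge r) (x : Fin 16) :
    (witnessPaths x).map (fun l => (witnessVars r e l.1, l.2)) = canonWord r e x := by
  have hlen := length_canonWord_eq r e x
  have hsg := map_snd_canonWord r e x
  apply List.ext_getElem
  · simp [witnessPaths, hlen]
  · intro k h₁ h₂
    have hk : k < (signs x).length := by simpa [witnessPaths] using h₁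
    have hk16 : k < 16 := lt_of_lt_of_le hk ((length_signs_le x).trans (by norm_num))
    have hx : (16 * x.val + k) / 16 = x.val := by omega
    have hkm : (16 * x.val + k) % 16 = k := by omega
    simp only [witnessPaths, List.getElem_map, List.getElem_finRange, witnessVars, Fin.val_mk, Fin.val_cast, hx, hkm,
      Fin.eta]
    have hget : (canonWord r e x).getD k (⟨0, 0⟩, true) = (canonWord r e x)[k] := List.getD_eq_getElem _ _ h₂
    rw [hget]
    have hs : (signs x).getD k true = ((canonWord r e x)[k]).2 := by
      rw [← hsg, List.getD_eq_getElem _ _ (by simpa using h₂), List.getElem_map]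
    rw [hs]

end TrivialWitness

/-! ## §2 The witness scheme and the satisfiability of the hypothesis package -/

/-- Left translations of the trivial group are isometries (all distances vanish). [folklore] -/
local instance TrivialWitness.instIsoL : IsIsometricSMul PUnit PUnit := ⟨fun _ x y => by simp⟩
/-- Right translations of the trivial group are isometries. [folklore] -/
local instance TrivialWitness.instIsoR : IsIsometricSMul PUnitᵐᵒᵖ PUnit := ⟨fun _ x y => by simp⟩

open TrivialWitness in
/-- **The degenerate block spin scheme**: trivial group, zero-dimensional Lie algebra, Federbush's words realised literally,
`Φ ≡ 1`, `F ≡ 0`, `F^L = 0`. [cite: Federbush1987PhaseCellVI, (1)–(6) p. 18–19, (13)–(18) p. 21; Federbush1986PhaseCellI, §1 p. 321–322] -/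
def trivialSystem : BlockSpinSystem where
  G := PUnit
  𝔤 := Fin 0 → ℝ
  lie := 0
  exp := fun _ => PUnit.unit
  M := 256
  vars := witnessVars
  paths := witnessPaths
  Φ := fun _ => PUnit.unit
  F := fun _ => 0
  FL := 0
  εF := 1
  εF_pos := one_pos
  F_spec := fun _ _ => rfl

/-- The group of the witness scheme is the trivial group (one element). [folklore] -/
local instance TrivialWitness.instSubsingletonG : Subsingleton trivialSystem.G := inferInstanceAs (Subsingleton PUnit)

namespace TrivialWitness

/-- All distances in the trivial group vanish. [folklore] -/
private theorem dist_G (a b : trivialSystem.G) : dist a b = 0 := by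
  rw [Subsingleton.elim a b, dist_self]

/-- Every element of the zero-dimensional algebra has norm `0`. [folklore] -/
private theorem norm_g_eq_zero (A : trivialSystem.𝔤) : ‖A‖ = 0 := by
  have : A = 0 := Subsingleton.elim (α := Fin 0 → ℝ) A 0
  rw [this, norm_zero]

/-- Every tuple of variables has norm `0`. [folklore] -/
private theorem norm_tuple_eq_zero (A : Fin trivialSystem.M → trivialSystem.𝔤) : ‖A‖ = 0 := by
  have : A = 0 := by funext α; exact Subsingleton.elim (α := Fin 0 → ℝ) _ _
  rw [this, norm_zero]

end TrivialWitness

open TrivialWitness in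
/-- **The hypothesis predicate `IsFederbushSystem` is satisfiable**: the degenerate scheme is a Federbush system (all
eleven fields; `paths_canonical` by `witnessPaths_map`, everything else by triviality of the group).
[cite: Federbush1987PhaseCellVI, (1)–(7) p. 17–19, (13)–(23) p. 21; Federbush1986PhaseCellI, §1 Fig. 1–2 p. 321–322] -/
theorem trivialSystem_isFederbushSystem : trivialSystem.IsFederbushSystem where
  paths_canonical := fun r e x => witnessPaths_map r e x
  FL_abelian := fun A => Subsingleton.elim (α := Fin 0 → ℝ) _ _
  property1 := continuous_const
  property2 := ⟨1, one_pos, fun gs _ h => le_of_eq (by rw [Subsingleton.elim h (trivialSystem.Φ gs)])⟩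
  analytic := by
    refine ⟨1, one_pos, fun A _ => analyticAt_const, rfl, ?_⟩
    show HasFDerivAt (fun _ : Fin trivialSystem.M → trivialSystem.𝔤 => (0 : trivialSystem.𝔤))
      (0 : (Fin trivialSystem.M → trivialSystem.𝔤) →L[ℝ] trivialSystem.𝔤) 0
    exact hasFDerivAt_const _ _
  estimates := by
    refine ⟨0, 1, one_pos, fun A _ => ?_⟩
    have hF : trivialSystem.Fprime = fun _ => (0 : trivialSystem.𝔤) := by
      funext B; exact Subsingleton.elim (α := Fin 0 → ℝ) _ _
    have hfd : fderiv ℝ (fun _ : Fin trivialSystem.M → trivialSystem.𝔤 => (0 : trivialSystem.𝔤)) = fun _ => 0 := by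
      funext B; simp
    rw [hF]
    refine ⟨by simp, differentiableAt_const _, by simp, ?_, ?_⟩
    · rw [hfd]; exact differentiableAt_const _
    · rw [hfd]
      have h5 : fderiv ℝ (fun _ : Fin trivialSystem.M → trivialSystem.𝔤 =>
          (0 : (Fin trivialSystem.M → trivialSystem.𝔤) →L[ℝ] trivialSystem.𝔤)) A = 0 := by simp
      rw [h5]
      exact le_of_eq ContinuousLinearMap.opNorm_zero
  exp_norm := ⟨1, one_pos, fun A _ => by rw [norm_g_eq_zero]; exact dist_G _ _⟩
  compact := inferInstanceAs (CompactSpace PUnit)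
  exp_line := fun _ _ _ => rfl
  lie_commutator := fun A B => by
    simp only [dist_G, mul_zero]
    exact tendsto_const_nhds

open TrivialWitness in
/-- **The T-F6-1 chart binder is satisfiable** (jointly with `IsFederbushSystem`). [cite: Federbush1987PhaseCellVI, (5)–(6) p. 19] -/
theorem trivialSystem_chart : ∃ ρ > (0 : ℝ), ∃ C ≥ (1 : ℝ),
    (∀ X Y : trivialSystem.𝔤, ‖X‖ < ρ → ‖Y‖ < ρ →
      C⁻¹ * ‖X - Y‖ ≤ dist (trivialSystem.exp X) (trivialSystem.exp Y) ∧
        dist (trivialSystem.exp X) (trivialSystem.exp Y) ≤ C * ‖X - Y‖) ∧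
    ∀ g : trivialSystem.G, absG g < ρ / C → ∃ X : trivialSystem.𝔤, ‖X‖ < ρ ∧ trivialSystem.exp X = g := by
  refine ⟨1, one_pos, 1, le_rfl, fun X Y _ _ => ?_, fun g _ => ⟨0, by simp, Subsingleton.elim _ _⟩⟩
  rw [norm_g_eq_zero (X - Y), dist_G]; simp

open TrivialWitness in
/-- **The BCH binder is satisfiable** (jointly with the above). [cite: Federbush1987PhaseCellIII, (1.7)–(1.9) p. 295;
Federbush1987PhaseCellVI, p. 18] -/
theorem trivialSystem_bch : ∃ ρ > (0 : ℝ), ∃ C : ℝ, ∀ X Y : trivialSystem.𝔤, ‖X‖ < ρ → ‖Y‖ < ρ →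
    dist (trivialSystem.exp X * trivialSystem.exp Y)
      (trivialSystem.exp (X + Y + (1 / 2 : ℝ) • trivialSystem.lie X Y)) ≤ C * (‖X‖ + ‖Y‖) ^ 3 :=
  ⟨1, one_pos, 0, fun X Y _ _ => by rw [dist_G]; simp⟩

/-- **Theorem 1 of record instantiates**: the hypotheses of `theorem1_of_chart` are met by the witness.
[cite: Federbush1987PhaseCellVI, Theorem 1 p. 20] -/
theorem trivialSystem_theorem1 : trivialSystem.Theorem1 :=
  trivialSystem.theorem1_of_chart trivialSystem_chart

/-- **Theorem 2 of record instantiates**: the hypotheses of `theorem2Oriented_of_chart` are met by the witness (so the proved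
implication is not vacuously hypothesised). [cite: Federbush1987PhaseCellVI, Theorem 2 p. 20] -/
theorem trivialSystem_theorem2 : trivialSystem.Theorem2Oriented :=
  trivialSystem.theorem2Oriented_of_chart trivialSystem_chart trivialSystem_bch

/-- The witness also satisfies the antecedent `IsFederbushSystem` inside the two statements, so their conclusions hold for it
outright (for every `C¹` potential: here all assignments are trivial). [cite: Federbush1987PhaseCellVI, Theorems 1–2 p. 20] -/
theorem trivialSystem_theorem2_conclusion (A : trivialSystem.Potential) (hA : ContDiff ℝ 1 A)
    (hdec : ∃ ε > (0 : ℝ), ∃ c : ℝ, ∀ x : E4, ∀ μ, ‖x‖ ^ (2 + ε) * ‖A x μ‖ < c ∧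
      ∀ ν, ‖x‖ ^ (2 + ε) * ‖fderiv ℝ (fun y => A y μ) x (unitVec ν)‖ < c)
    (g : (r : ℕ) → Edge r → trivialSystem.G) (hg : trivialSystem.IsAssociated A g) :
    Tendsto (fun r => trivialSystem.latticeActionOriented r (g r)) atTop (𝓝 (trivialSystem.contActionVI A)) :=
  (trivialSystem_theorem2 trivialSystem_isFederbushSystem A hA hdec g hg).2.2

end

end Literature.MathematicalPhysics.QuantumFieldTheory.Federbush1986
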